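import Literature.MathematicalPhysics.QuantumFieldTheory.Balaban1983to89.Node00.Record13InhabitedOfThm1CMonotone

/-!
# NODE 00 (YM-PLAN Track A) — STAGE 13, REV 18: THE SEPARATION-GUARDED ROW P11 PER PARTITION-COMPATIBLE RUN — node00-def-P11's FAITHFUL CHAIN (FILE 5 v1.2)
# LIFTED TO THE STAGE-13 PARAMETER WITH (C2) AS THE RUN-LEVEL ANTECEDENT `PartCompat₁₃ θ p n` (plan g67 WORD-T2, `Record13` v1.2), AT `θ` AND AT `θ₁₅ᶜ = theta13OfThm1C`

Cell `pub-ymgap`, seat `pub-ymgap-node00-def-K0a` (g5), FILE 12b (re-cut of FILE 11b §1∕§3: there (C2) «`L^j·M·R_j ∣ 2L^{m+K}`» was a GLOBAL hypothesis `hC2` over all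
windowed runs — false as a θ-level ∀-sentence at fixed `(K, m)` (deep windowed histories put `R_j` beyond the torus); node00-def-T's v1.2 `bg` field carries it
POINTWISE as the second antecedent `PartCompat₁₃ F N θ p n` = `hC2` at `(p, n)` verbatim, so the supplier must conclude per run).  [15] = [Balaban1985Variational],
[6] = [Balaban1985RegularSpaces], [III] = [Balaban1988Convergent], [I] = [Balaban1987RG1].

WHAT THIS FILE PROVES (theorems only; every other hypothesis displayed verbatim as in FILE 11b so node00-def-P11's FILES 6∕7 plug in by name).
* §1 ★ `Stage13Params.bgSepAt_of_thm1ScaledSep` — 11b's `bgSep_of_thm1ScaledSep` with `hC2` replaced by the run-level antecedent: conclusion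
  `∀ p n, n ≤ p.K → Step.InInterval … → PartCompat₁₃ F N θ p n → ∀ s, SeqSeparated θ.ν.M₁ s → ∀ 𝐖 ∈ suppOfRecord₁₃ θ p n s, ∀ j X, (I) ∧ (MS)` — exactly the body of
  v1.2's `Provisos₁₃Sep.bg` (`Record13SepLiveSelector` §1 `bgProvisoΛ_suppSep_iff`); proof = 11b's, `hpc` for `hC2 p (n+1) hn hw` (def-P11's `bgRowAt_of_thm1ScaledSep` is per level).
* §2 AT `θ₁₅ᶜ`: ★★★ `bgSepAt_theta13OfThm1C_of_thm1ScaledSep (hε hε' hB ha₀ ha₁) (h15 : VariationalThm1ScaledSep F N B₃ a₀ a₁) (hcomp) (h3I) (h3MS)` (every letter inequality,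
  (C1) and no-wrapping by FILE 11b §2) and `…_of_monotone (hmono)` ((hcomp) by FILE 11c) — the v1.2 row P11 at `θ₁₅ᶜ` ⟸ (R1′) + (R2) + ONE run condition (hcomp)∕(hmono).

HONEST FRAMING.  Composition of tree theorems + index bookkeeping; CONDITIONAL on node00-def-P11's FAITHFUL named fact `VariationalThm1ScaledSep` ([15] Thm 1 (8) for
separated sequences — a `Prop` hypothesis, NEVER asserted; kernel floor `2·L² ≤ B₃`, dag-n21-c), on the displayed derivative members (h3I)∕(h3MS) ([15] Thm 1 (9)–(10)) and on
(hcomp)∕(hmono); nothing of Bałaban asserted; NOT a discharge; counts unmoved (typed 28∕28 · discharged 5∕28); one finite 𝕋⁴ programme at fixed ε — NOT continuum ∕ OS ∕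
mass gap ∕ Clay.  No `sorry`, `axiom`, `def`, `instance`, `notation`.
-/

noncomputable section

open MeasureTheory
open scoped Matrix.Norms.L2Operator

namespace Literature.MathematicalPhysics.QuantumFieldTheory.Balaban1983to89.Node00

open T4Continuum B14.Eq218Concrete B15DeterminingSets B12RegularSpaces111 B14RegularSpaces234 B14Radii T4AxialGaugeSmallField

/-! ## §1. ★ node00-def-P11's FAITHFUL CHAIN LIFTED TO THE STAGE-13 PARAMETER, PER PARTITION-COMPATIBLE RUN (all other hypotheses displayed as in FILE 11b) -/

section LiftAt

variable {F : T4Family} {N : ℕ} [NeZero N]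

/-- **★ THE SEPARATION-GUARDED ROW P11 AT THE STAGE-13 RECORD, PER PARTITION-COMPATIBLE RUN** — FILE 11b's `Stage13Params.bgSep_of_thm1ScaledSep` with the
compatibility (C2) of the 𝐃_j-partitions consumed POINTWISE from the run-level antecedent `PartCompat₁₃ F N θ p n` ([III] p. 257; v1.2's second antecedent of row `bg`)
instead of a global hypothesis: from (R1′) `VariationalThm1ScaledSep`, (R2) `h3I` ∕ `h3MS`, the comparability (hcomp), (C1), no wrapping and the letter inequalities — at
every run `p`, level `n ≤ K` in the window with compatible partitions, SEPARATED `s`, retained `𝐖`, scale `1 ≤ j ≤ n`, domain `X`: the two guarded memberships.  Level `0`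
vacuous; level `n + 1` = def-P11's per-level `bgRowAt_of_thm1ScaledSep` at `S := settingOfRecord₁₃ F N θ p` after `UbgOfRecord₁₃_succ`.  A REDUCTION — nothing of Bałaban asserted.
[cite: Balaban1985Variational, Thm 1 (8)–(10) p.279; Balaban1985RegularSpaces, (1.3)–(1.8) p.77; Balaban1988Convergent, (2.7)–(2.8) pp.255–256, (2.27)–(2.28) p.259, (2.34)–(2.41) p.261, p.257; Balaban1987RG1, (1.11)–(1.16) p.262] -/
theorem Stage13Params.bgSepAt_of_thm1ScaledSep (θ : Stage13Params F N) (hθ : θ.Admissible F N) (hRz : θ.Rz = RzOfRecord F N)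
    {B₃ a₀ a₁ : ℝ} (h15 : VariationalThm1ScaledSep F N B₃ a₀ a₁) (hB₃ : 0 ≤ B₃) (hM : 0 < θ.τ9.M) (ha₀ : θ.ν.εreg ≤ a₀)
    (hnum : ∀ (p : B12.RunParams) (n : ℕ), n ≤ p.K → Step.InInterval θ.γ n (gOfRecord₁₃ F N θ p) → ∀ m, m ≤ n →
      0 < θ.s2.cR * epsOfRecord θ.ν (gOfRecord₁₃ F N θ p) m ∧ θ.s2.cR * epsOfRecord θ.ν (gOfRecord₁₃ F N θ p) m ≤ a₁ ∧
        B₃ * (θ.s2.cR * epsOfRecord θ.ν (gOfRecord₁₃ F N θ p) m) ≤ θ.ν.εreg)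
    (hcomp : ∀ (p : B12.RunParams) (n : ℕ), n ≤ p.K → Step.InInterval θ.γ n (gOfRecord₁₃ F N θ p) → ∀ m, m < n →
      θ.s2.cR * epsOfRecord θ.ν (gOfRecord₁₃ F N θ p) m ≤ 2 * (θ.s2.cR * epsOfRecord θ.ν (gOfRecord₁₃ F N θ p) (m + 1)))
    (hBα : ∀ (p : B12.RunParams) (n : ℕ), n ≤ p.K → Step.InInterval θ.γ n (gOfRecord₁₃ F N θ p) → ∀ m, 1 ≤ m → m ≤ n →
      B₃ * (θ.s2.cR * epsOfRecord θ.ν (gOfRecord₁₃ F N θ p) m) ≤ (1 - θ.s2.βc) * (lfOfRecord₁₂ F N θ.toStage12Params).alpha0 (gOfRecord₁₃ F N θ p m))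
    (hsN : ∀ (p : B12.RunParams) (n : ℕ), n ≤ p.K → ∀ n', 1 ≤ n' → n' ≤ n + 1 →
      ((B14.Eq213MaximalDomains.side (F.P p.K).L θ.τ9.M n' : ℕ) : ℤ) < (F.P p.K).sitesPerDir 0)
    (hcB : ∀ p : B12.RunParams, 2 * (((F.P p.K).d - 1 : ℕ) : ℝ) * ((F.P p.K).L * θ.τ9.M) < θ.s2.cB)
    (hBCM : ∀ p : B12.RunParams, 2 * (((F.P p.K).d - 1 : ℕ) : ℝ) * θ.τ9.M < θ.s2.B * θ.s2.C * θ.s2.Mr)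
    (hsmallI : ∀ (p : B12.RunParams) (n : ℕ), n ≤ p.K → Step.InInterval θ.γ n (gOfRecord₁₃ F N θ p) → ∀ j, 1 ≤ j → j ≤ n →
      (((F.P p.K).d - 1 : ℕ) : ℝ) * ((F.P p.K).L * θ.τ9.M) * (F.P p.K).eta j * (B₃ * (θ.s2.cR * epsOfRecord θ.ν (gOfRecord₁₃ F N θ p) j)) ≤ 1 / 2)
    (hsmallMS : ∀ (p : B12.RunParams) (n : ℕ), n ≤ p.K → Step.InInterval θ.γ n (gOfRecord₁₃ F N θ p) → ∀ m, 1 ≤ m → m ≤ n →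
      (((F.P p.K).d - 1 : ℕ) : ℝ) * θ.τ9.M * (F.P p.K).eta m * (B₃ * (θ.s2.cR * epsOfRecord θ.ν (gOfRecord₁₃ F N θ p) m)) ≤ 1 / 2)
    (hC1 : ∀ (p : B12.RunParams) (n : ℕ), n ≤ p.K → Step.InInterval θ.γ n (gOfRecord₁₃ F N θ p) → ∀ j, 1 ≤ j → j ≤ n →
      ∃ t : ℕ, 0 < t ∧ RkOfRecord (F.P p.K).L θ.ν.r (gOfRecord₁₃ F N θ p j) = (F.P p.K).L * t)
    (h3I : ∀ (p : B12.RunParams) (n : ℕ), n ≤ p.K → Step.InInterval θ.γ n (gOfRecord₁₃ F N θ p) →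
      ∀ s : SeqOfRecord F θ.ν θ.τ9.M (gOfRecord₁₃ F N θ p) p.K n, Sect2.SeqSeparated θ.ν.M₁ s → ∀ W : MSField (F.P p.K) (SU N),
      W ∈ suppOfRecord₁₃ F N θ p n s → W ∈ solvableDom (avOfRecord F N p.K) (regMSOfRecord F N θ.ν p.K n s.Ω) (genSet s.Ω n) →
      ∀ j, 1 ≤ j → j ≤ n → ∀ X : (Sect2.domSys (F.P p.K) θ.τ9.M j).Dom, Sect2.domSites (F.P p.K) θ.τ9.M j X ⊆ s.Λ j →
      ∀ a ∈ cubeIndices (F.P p.K) (B14.Eq213MaximalDomains.side (F.P p.K).L θ.τ9.M (j + 1)),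
        (cubeEnl (F.P p.K) (B14.Eq213MaximalDomains.side (F.P p.K).L θ.τ9.M (j + 1)) a 0 ∩ Sect2.domSites (F.P p.K) θ.τ9.M j X).Nonempty →
        ∀ q ∈ (Sect2.regionOfSet (F.P p.K) (cubeEnl (F.P p.K) (B14.Eq213MaximalDomains.side (F.P p.K).L θ.τ9.M (j + 1)) a 0 ∩
            Sect2.domSites (F.P p.K) θ.τ9.M j X)).dpairs,
          ‖grad ((F.P p.K).eta j) q.2.1 (fun y => axialPotential (UbgMSOfRecord F N θ.ν θ.τ9.M (gOfRecord₁₃ F N θ p) p.K n s W)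
            (boxLo (B14.Eq213MaximalDomains.side (F.P p.K).L θ.τ9.M (j + 1)) a) (boxHi (B14.Eq213MaximalDomains.side (F.P p.K).L θ.τ9.M (j + 1)) a) ((F.P p.K).eta j) ⟨y, q.2.2⟩) q.1‖ <
            θ.s2.cB * (lfOfRecord₁₂ F N θ.toStage12Params).alpha0 (gOfRecord₁₃ F N θ p j))
    (h3MS : ∀ (p : B12.RunParams) (n : ℕ), n ≤ p.K → Step.InInterval θ.γ n (gOfRecord₁₃ F N θ p) →
      ∀ s : SeqOfRecord F θ.ν θ.τ9.M (gOfRecord₁₃ F N θ p) p.K n, Sect2.SeqSeparated θ.ν.M₁ s → ∀ W : MSField (F.P p.K) (SU N),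
      W ∈ suppOfRecord₁₃ F N θ p n s → W ∈ solvableDom (avOfRecord F N p.K) (regMSOfRecord F N θ.ν p.K n s.Ω) (genSet s.Ω n) →
      ∀ j, 1 ≤ j → j ≤ n → ∀ X : (Sect2.domSys (F.P p.K) θ.τ9.M j).Dom, ∀ m, 1 ≤ m → m ≤ j →
      ∀ a ∈ cubeIndices (F.P p.K) (B14.Eq213MaximalDomains.side (F.P p.K).L θ.τ9.M m),
        (cubeEnl (F.P p.K) (B14.Eq213MaximalDomains.side (F.P p.K).L θ.τ9.M m) a 0 ∩ Sect2.domSites (F.P p.K) θ.τ9.M j X).Nonempty →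
        cubeEnl (F.P p.K) (B14.Eq213MaximalDomains.side (F.P p.K).L θ.τ9.M m) a 0 ⊆ s.Ω m →
        ∀ q ∈ (Sect2.regionOfSet (F.P p.K) (cubeEnl (F.P p.K) (B14.Eq213MaximalDomains.side (F.P p.K).L θ.τ9.M m) a 0 ∩
            Sect2.domSites (F.P p.K) θ.τ9.M j X)).dpairs,
          (((F.P p.K).L : ℝ) ^ m * (F.P p.K).eta j) ^ 2 *
            ‖grad ((F.P p.K).eta j) q.2.1 (fun y => axialPotential (UbgMSOfRecord F N θ.ν θ.τ9.M (gOfRecord₁₃ F N θ p) p.K n s W)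
              (boxLo (B14.Eq213MaximalDomains.side (F.P p.K).L θ.τ9.M m) a) (boxHi (B14.Eq213MaximalDomains.side (F.P p.K).L θ.τ9.M m) a) ((F.P p.K).eta j) ⟨y, q.2.2⟩) q.1‖ <
            rad238 θ.s2.B θ.s2.C θ.s2.Mr ((lfOfRecord₁₂ F N θ.toStage12Params).alpha0 (gOfRecord₁₃ F N θ p m))) :
    ∀ (p : B12.RunParams) (n : ℕ), n ≤ p.K → Step.InInterval θ.γ n (gOfRecord₁₃ F N θ p) → PartCompat₁₃ F N θ p n →
      ∀ s : SeqOfRecord F θ.ν θ.τ9.M (gOfRecord₁₃ F N θ p) p.K n, Sect2.SeqSeparated θ.ν.M₁ s →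
      ∀ W : MSField (F.P p.K) (SU N), W ∈ suppOfRecord₁₃ F N θ p n s →
      ∀ j, 1 ≤ j → j ≤ n → ∀ X : (Sect2.domSys (F.P p.K) θ.τ9.M j).Dom,
      (Sect2.domSites (F.P p.K) θ.τ9.M j X ⊆ s.Λ j →
        Sect2.ofBackgroundC (settingOfRecord₁₃ F N θ p).ι (UbgOfRecord₁₃ F N θ p n s W) ∈
          Sect2.spaceI (settingOfRecord₁₃ F N θ p) (θ.Rz p.K) θ.τ9.M j (Sect2.domSites (F.P p.K) θ.τ9.M j X)
            ((settingOfRecord₁₃ F N θ p).lf.alpha0 ((settingOfRecord₁₃ F N θ p).flow.g j)) ((settingOfRecord₁₃ F N θ p).lf.alpha1 ((settingOfRecord₁₃ F N θ p).flow.g j))) ∧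
      (Sect2.admB (F.P p.K) θ.ν θ.τ9.M (gOfRecord₁₃ F N θ p) s.Ω s.Λ j (Sect2.domSites (F.P p.K) θ.τ9.M j X) = true →
        Sect2.ofBackgroundC (settingOfRecord₁₃ F N θ p).ι (UbgOfRecord₁₃ F N θ p n s W) ∈
          Sect2.spaceMS (settingOfRecord₁₃ F N θ p) (θ.Rz p.K) θ.τ9.M j (Sect2.domSites (F.P p.K) θ.τ9.M j X) s.Ω) := by
  intro p n hn hw hpc
  rw [hRz]
  cases n with
  | zero =>
    intro s _ W _ j h1 hj
    exfalso
    omega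
  | succ n =>
    rw [UbgOfRecord₁₃_succ]
    exact fun s hsep W hW j h1 hj X =>
      bgRowAt_of_thm1ScaledSep h15 (settingOfRecord₁₃ F N θ p) rfl rfl (settingOfRecord₁₃_laws F N θ p) (settingOfRecord₁₃_pos F N θ hθ.1.pos p)
        θ.ν hM p.K (n + 1) θ.s2.cR hB₃ (hnum p (n + 1) hn hw) ha₀ (hcomp p (n + 1) hn hw) (fun m _ hm => alphaPos₁₃_of_inInterval hθ hw hm)
        (hBα p (n + 1) hn hw) (hsN p (n + 1) hn) (hcB p) (hBCM p) (hsmallI p (n + 1) hn hw) (hsmallMS p (n + 1) hn hw) (hC1 p (n + 1) hn hw)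
        hpc s hsep (h3I p (n + 1) hn hw s hsep) (h3MS p (n + 1) hn hw s hsep) W hW j h1 hj X

end LiftAt

/-! ## §2. ★★★ THE v1.2 ROW P11 AT `θ₁₅ᶜ`, PER PARTITION-COMPATIBLE RUN, from (R1′) + (R2) + one run condition -/

section AtWitness

variable {F : T4Family} {N : ℕ} [NeZero N] {ε₀ ε₂₉ B₃ a₀ a₁ : ℝ}

/-- **★★★ THE SEPARATION-GUARDED ROW P11 AT `θ₁₅ᶜ = theta13OfThm1C F N ε₀ ε₂₉ B₃ a₀ a₁`, PER PARTITION-COMPATIBLE RUN** — FILE 11b's ★★★ with (C2) moved into the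
run-level antecedent: from the signs, (R1′) the FAITHFUL named fact `VariationalThm1ScaledSep F N B₃ a₀ a₁`, (R2) the displayed derivative members `h3I` ∕ `h3MS`, and the ONE
displayed run condition (hcomp) «`cR·ε_m ≤ 2·cR·ε_{m+1}` along every windowed run» ((2.7)–(2.8)); every letter inequality, (C1) and no-wrapping by FILE 11b §2.  The conclusion
is verbatim the body of v1.2's `Provisos₁₃Sep.bg` at `θ₁₅ᶜ`.  CONDITIONAL; nothing of Bałaban asserted. [cite: Balaban1985Variational, Thm 1 (8)–(10) p.279; Balaban1985RegularSpaces, (1.3)–(1.8) p.77; Balaban1988Convergent, (2.7)–(2.8) pp.255–256, (2.27)–(2.28) p.259, (2.34)–(2.41) p.261, p.257; Balaban1987RG1, (1.11)–(1.16) p.262] -/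
theorem bgSepAt_theta13OfThm1C_of_thm1ScaledSep (hε : 0 < ε₀) (hε' : 0 < ε₂₉) (hB : 0 ≤ B₃) (ha₀ : 0 < a₀) (ha₁ : 0 < a₁)
    (h15 : VariationalThm1ScaledSep F N B₃ a₀ a₁)
    (hcomp : ∀ (p : B12.RunParams) (n : ℕ), n ≤ p.K → Step.InInterval (theta13OfThm1C F N ε₀ ε₂₉ B₃ a₀ a₁).γ n (gOfRecord₁₃ F N (theta13OfThm1C F N ε₀ ε₂₉ B₃ a₀ a₁) p) → ∀ m, m < n →
      (theta13OfThm1C F N ε₀ ε₂₉ B₃ a₀ a₁).s2.cR * epsOfRecord (theta13OfThm1C F N ε₀ ε₂₉ B₃ a₀ a₁).ν (gOfRecord₁₃ F N (theta13OfThm1C F N ε₀ ε₂₉ B₃ a₀ a₁) p) m ≤ 2 * ((theta13OfThm1C F N ε₀ ε₂₉ B₃ a₀ a₁).s2.cR * epsOfRecord (theta13OfThm1C F N ε₀ ε₂₉ B₃ a₀ a₁).ν (gOfRecord₁₃ F N (theta13OfThm1C F N ε₀ ε₂₉ B₃ a₀ a₁) p) (m + 1)))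
    (h3I : ∀ (p : B12.RunParams) (n : ℕ), n ≤ p.K → Step.InInterval (theta13OfThm1C F N ε₀ ε₂₉ B₃ a₀ a₁).γ n (gOfRecord₁₃ F N (theta13OfThm1C F N ε₀ ε₂₉ B₃ a₀ a₁) p) →
      ∀ s : SeqOfRecord F (theta13OfThm1C F N ε₀ ε₂₉ B₃ a₀ a₁).ν (theta13OfThm1C F N ε₀ ε₂₉ B₃ a₀ a₁).τ9.M (gOfRecord₁₃ F N (theta13OfThm1C F N ε₀ ε₂₉ B₃ a₀ a₁) p) p.K n, Sect2.SeqSeparated (theta13OfThm1C F N ε₀ ε₂₉ B₃ a₀ a₁).ν.M₁ s → ∀ W : MSField (F.P p.K) (SU N),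
      W ∈ suppOfRecord₁₃ F N (theta13OfThm1C F N ε₀ ε₂₉ B₃ a₀ a₁) p n s → W ∈ solvableDom (avOfRecord F N p.K) (regMSOfRecord F N (theta13OfThm1C F N ε₀ ε₂₉ B₃ a₀ a₁).ν p.K n s.Ω) (genSet s.Ω n) →
      ∀ j, 1 ≤ j → j ≤ n → ∀ X : (Sect2.domSys (F.P p.K) (theta13OfThm1C F N ε₀ ε₂₉ B₃ a₀ a₁).τ9.M j).Dom, Sect2.domSites (F.P p.K) (theta13OfThm1C F N ε₀ ε₂₉ B₃ a₀ a₁).τ9.M j X ⊆ s.Λ j →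
      ∀ a ∈ cubeIndices (F.P p.K) (B14.Eq213MaximalDomains.side (F.P p.K).L (theta13OfThm1C F N ε₀ ε₂₉ B₃ a₀ a₁).τ9.M (j + 1)),
        (cubeEnl (F.P p.K) (B14.Eq213MaximalDomains.side (F.P p.K).L (theta13OfThm1C F N ε₀ ε₂₉ B₃ a₀ a₁).τ9.M (j + 1)) a 0 ∩ Sect2.domSites (F.P p.K) (theta13OfThm1C F N ε₀ ε₂₉ B₃ a₀ a₁).τ9.M j X).Nonempty →
        ∀ q ∈ (Sect2.regionOfSet (F.P p.K) (cubeEnl (F.P p.K) (B14.Eq213MaximalDomains.side (F.P p.K).L (theta13OfThm1C F N ε₀ ε₂₉ B₃ a₀ a₁).τ9.M (j + 1)) a 0 ∩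
            Sect2.domSites (F.P p.K) (theta13OfThm1C F N ε₀ ε₂₉ B₃ a₀ a₁).τ9.M j X)).dpairs,
          ‖grad ((F.P p.K).eta j) q.2.1 (fun y => axialPotential (UbgMSOfRecord F N (theta13OfThm1C F N ε₀ ε₂₉ B₃ a₀ a₁).ν (theta13OfThm1C F N ε₀ ε₂₉ B₃ a₀ a₁).τ9.M (gOfRecord₁₃ F N (theta13OfThm1C F N ε₀ ε₂₉ B₃ a₀ a₁) p) p.K n s W)
            (boxLo (B14.Eq213MaximalDomains.side (F.P p.K).L (theta13OfThm1C F N ε₀ ε₂₉ B₃ a₀ a₁).τ9.M (j + 1)) a) (boxHi (B14.Eq213MaximalDomains.side (F.P p.K).L (theta13OfThm1C F N ε₀ ε₂₉ B₃ a₀ a₁).τ9.M (j + 1)) a) ((F.P p.K).eta j) ⟨y, q.2.2⟩) q.1‖ <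
            (theta13OfThm1C F N ε₀ ε₂₉ B₃ a₀ a₁).s2.cB * (lfOfRecord₁₂ F N (theta13OfThm1C F N ε₀ ε₂₉ B₃ a₀ a₁).toStage12Params).alpha0 (gOfRecord₁₃ F N (theta13OfThm1C F N ε₀ ε₂₉ B₃ a₀ a₁) p j))
    (h3MS : ∀ (p : B12.RunParams) (n : ℕ), n ≤ p.K → Step.InInterval (theta13OfThm1C F N ε₀ ε₂₉ B₃ a₀ a₁).γ n (gOfRecord₁₃ F N (theta13OfThm1C F N ε₀ ε₂₉ B₃ a₀ a₁) p) →
      ∀ s : SeqOfRecord F (theta13OfThm1C F N ε₀ ε₂₉ B₃ a₀ a₁).ν (theta13OfThm1C F N ε₀ ε₂₉ B₃ a₀ a₁).τ9.M (gOfRecord₁₃ F N (theta13OfThm1C F N ε₀ ε₂₉ B₃ a₀ a₁) p) p.K n, Sect2.SeqSeparated (theta13OfThm1C F N ε₀ ε₂₉ B₃ a₀ a₁).ν.M₁ s → ∀ W : MSField (F.P p.K) (SU N),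
      W ∈ suppOfRecord₁₃ F N (theta13OfThm1C F N ε₀ ε₂₉ B₃ a₀ a₁) p n s → W ∈ solvableDom (avOfRecord F N p.K) (regMSOfRecord F N (theta13OfThm1C F N ε₀ ε₂₉ B₃ a₀ a₁).ν p.K n s.Ω) (genSet s.Ω n) →
      ∀ j, 1 ≤ j → j ≤ n → ∀ X : (Sect2.domSys (F.P p.K) (theta13OfThm1C F N ε₀ ε₂₉ B₃ a₀ a₁).τ9.M j).Dom, ∀ m, 1 ≤ m → m ≤ j →
      ∀ a ∈ cubeIndices (F.P p.K) (B14.Eq213MaximalDomains.side (F.P p.K).L (theta13OfThm1C F N ε₀ ε₂₉ B₃ a₀ a₁).τ9.M m),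
        (cubeEnl (F.P p.K) (B14.Eq213MaximalDomains.side (F.P p.K).L (theta13OfThm1C F N ε₀ ε₂₉ B₃ a₀ a₁).τ9.M m) a 0 ∩ Sect2.domSites (F.P p.K) (theta13OfThm1C F N ε₀ ε₂₉ B₃ a₀ a₁).τ9.M j X).Nonempty →
        cubeEnl (F.P p.K) (B14.Eq213MaximalDomains.side (F.P p.K).L (theta13OfThm1C F N ε₀ ε₂₉ B₃ a₀ a₁).τ9.M m) a 0 ⊆ s.Ω m →
        ∀ q ∈ (Sect2.regionOfSet (F.P p.K) (cubeEnl (F.P p.K) (B14.Eq213MaximalDomains.side (F.P p.K).L (theta13OfThm1C F N ε₀ ε₂₉ B₃ a₀ a₁).τ9.M m) a 0 ∩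
            Sect2.domSites (F.P p.K) (theta13OfThm1C F N ε₀ ε₂₉ B₃ a₀ a₁).τ9.M j X)).dpairs,
          (((F.P p.K).L : ℝ) ^ m * (F.P p.K).eta j) ^ 2 *
            ‖grad ((F.P p.K).eta j) q.2.1 (fun y => axialPotential (UbgMSOfRecord F N (theta13OfThm1C F N ε₀ ε₂₉ B₃ a₀ a₁).ν (theta13OfThm1C F N ε₀ ε₂₉ B₃ a₀ a₁).τ9.M (gOfRecord₁₃ F N (theta13OfThm1C F N ε₀ ε₂₉ B₃ a₀ a₁) p) p.K n s W)
              (boxLo (B14.Eq213MaximalDomains.side (F.P p.K).L (theta13OfThm1C F N ε₀ ε₂₉ B₃ a₀ a₁).τ9.M m) a) (boxHi (B14.Eq213MaximalDomains.side (F.P p.K).L (theta13OfThm1C F N ε₀ ε₂₉ B₃ a₀ a₁).τ9.M m) a) ((F.P p.K).eta j) ⟨y, q.2.2⟩) q.1‖ <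
            rad238 (theta13OfThm1C F N ε₀ ε₂₉ B₃ a₀ a₁).s2.B (theta13OfThm1C F N ε₀ ε₂₉ B₃ a₀ a₁).s2.C (theta13OfThm1C F N ε₀ ε₂₉ B₃ a₀ a₁).s2.Mr ((lfOfRecord₁₂ F N (theta13OfThm1C F N ε₀ ε₂₉ B₃ a₀ a₁).toStage12Params).alpha0 (gOfRecord₁₃ F N (theta13OfThm1C F N ε₀ ε₂₉ B₃ a₀ a₁) p m))) :
    ∀ (p : B12.RunParams) (n : ℕ), n ≤ p.K → Step.InInterval (theta13OfThm1C F N ε₀ ε₂₉ B₃ a₀ a₁).γ n (gOfRecord₁₃ F N (theta13OfThm1C F N ε₀ ε₂₉ B₃ a₀ a₁) p) → PartCompat₁₃ F N (theta13OfThm1C F N ε₀ ε₂₉ B₃ a₀ a₁) p n →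
      ∀ s : SeqOfRecord F (theta13OfThm1C F N ε₀ ε₂₉ B₃ a₀ a₁).ν (theta13OfThm1C F N ε₀ ε₂₉ B₃ a₀ a₁).τ9.M (gOfRecord₁₃ F N (theta13OfThm1C F N ε₀ ε₂₉ B₃ a₀ a₁) p) p.K n, Sect2.SeqSeparated (theta13OfThm1C F N ε₀ ε₂₉ B₃ a₀ a₁).ν.M₁ s →
      ∀ W : MSField (F.P p.K) (SU N), W ∈ suppOfRecord₁₃ F N (theta13OfThm1C F N ε₀ ε₂₉ B₃ a₀ a₁) p n s →
      ∀ j, 1 ≤ j → j ≤ n → ∀ X : (Sect2.domSys (F.P p.K) (theta13OfThm1C F N ε₀ ε₂₉ B₃ a₀ a₁).τ9.M j).Dom,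
      (Sect2.domSites (F.P p.K) (theta13OfThm1C F N ε₀ ε₂₉ B₃ a₀ a₁).τ9.M j X ⊆ s.Λ j →
        Sect2.ofBackgroundC (settingOfRecord₁₃ F N (theta13OfThm1C F N ε₀ ε₂₉ B₃ a₀ a₁) p).ι (UbgOfRecord₁₃ F N (theta13OfThm1C F N ε₀ ε₂₉ B₃ a₀ a₁) p n s W) ∈
          Sect2.spaceI (settingOfRecord₁₃ F N (theta13OfThm1C F N ε₀ ε₂₉ B₃ a₀ a₁) p) ((theta13OfThm1C F N ε₀ ε₂₉ B₃ a₀ a₁).Rz p.K) (theta13OfThm1C F N ε₀ ε₂₉ B₃ a₀ a₁).τ9.M j (Sect2.domSites (F.P p.K) (theta13OfThm1C F N ε₀ ε₂₉ B₃ a₀ a₁).τ9.M j X)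
            ((settingOfRecord₁₃ F N (theta13OfThm1C F N ε₀ ε₂₉ B₃ a₀ a₁) p).lf.alpha0 ((settingOfRecord₁₃ F N (theta13OfThm1C F N ε₀ ε₂₉ B₃ a₀ a₁) p).flow.g j)) ((settingOfRecord₁₃ F N (theta13OfThm1C F N ε₀ ε₂₉ B₃ a₀ a₁) p).lf.alpha1 ((settingOfRecord₁₃ F N (theta13OfThm1C F N ε₀ ε₂₉ B₃ a₀ a₁) p).flow.g j))) ∧
      (Sect2.admB (F.P p.K) (theta13OfThm1C F N ε₀ ε₂₉ B₃ a₀ a₁).ν (theta13OfThm1C F N ε₀ ε₂₉ B₃ a₀ a₁).τ9.M (gOfRecord₁₃ F N (theta13OfThm1C F N ε₀ ε₂₉ B₃ a₀ a₁) p) s.Ω s.Λ j (Sect2.domSites (F.P p.K) (theta13OfThm1C F N ε₀ ε₂₉ B₃ a₀ a₁).τ9.M j X) = true →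
        Sect2.ofBackgroundC (settingOfRecord₁₃ F N (theta13OfThm1C F N ε₀ ε₂₉ B₃ a₀ a₁) p).ι (UbgOfRecord₁₃ F N (theta13OfThm1C F N ε₀ ε₂₉ B₃ a₀ a₁) p n s W) ∈
          Sect2.spaceMS (settingOfRecord₁₃ F N (theta13OfThm1C F N ε₀ ε₂₉ B₃ a₀ a₁) p) ((theta13OfThm1C F N ε₀ ε₂₉ B₃ a₀ a₁).Rz p.K) (theta13OfThm1C F N ε₀ ε₂₉ B₃ a₀ a₁).τ9.M j (Sect2.domSites (F.P p.K) (theta13OfThm1C F N ε₀ ε₂₉ B₃ a₀ a₁).τ9.M j X) s.Ω) :=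
  (theta13OfThm1C F N ε₀ ε₂₉ B₃ a₀ a₁).bgSepAt_of_thm1ScaledSep (admissible_theta13OfThm1C F N hε hε' hB ha₀ ha₁) rfl h15 hB
    (by rw [theta13OfThm1C_τ9_M]; exact Nat.one_pos) (theta13OfThm1C_εreg F N ε₀ ε₂₉ B₃ a₀ a₁).le
    (hnum_theta13OfThm1C hB ha₀ ha₁) hcomp (hBα_theta13OfThm1C hB ha₀.le ha₁.le) hsN_theta13OfThm1C hcB_theta13OfThm1C hBCM_theta13OfThm1C
    (hsmallI_theta13OfThm1C hB ha₀ ha₁) (hsmallMS_theta13OfThm1C hB ha₀ ha₁) hC1_theta13OfThm1C h3I h3MS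

/-- **★★★ … WITH THE RUN CONDITION «MONOTONE WINDOWED HISTORY»** ((hcomp) discharged by FILE 11c's `hcomp_theta13OfThm1C_of_monotone`; monotonicity = the DAG's displayed
β-sign input, plan's K0⁗ stub `stub_monotoneHistory13`). [cite: Balaban1985Variational, Thm 1 (8)–(10) p.279; Balaban1988Convergent, (2.7)–(2.8) pp.255–256, (2.28) p.259, p.257; Balaban1985RegularSpaces, (1.3)–(1.8) p.77; Balaban1987RG1, Thm 1 p.259] -/
theorem bgSepAt_theta13OfThm1C_of_thm1ScaledSep_of_monotone (hε : 0 < ε₀) (hε' : 0 < ε₂₉) (hB : 0 ≤ B₃) (ha₀ : 0 < a₀) (ha₁ : 0 < a₁)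
    (h15 : VariationalThm1ScaledSep F N B₃ a₀ a₁)
    (hmono : ∀ (p : B12.RunParams) (n : ℕ), n ≤ p.K → Step.InInterval (theta13OfThm1C F N ε₀ ε₂₉ B₃ a₀ a₁).γ n (gOfRecord₁₃ F N (theta13OfThm1C F N ε₀ ε₂₉ B₃ a₀ a₁) p) → ∀ m, m < n →
      gOfRecord₁₃ F N (theta13OfThm1C F N ε₀ ε₂₉ B₃ a₀ a₁) p m ≤ gOfRecord₁₃ F N (theta13OfThm1C F N ε₀ ε₂₉ B₃ a₀ a₁) p (m + 1))
    (h3I : ∀ (p : B12.RunParams) (n : ℕ), n ≤ p.K → Step.InInterval (theta13OfThm1C F N ε₀ ε₂₉ B₃ a₀ a₁).γ n (gOfRecord₁₃ F N (theta13OfThm1C F N ε₀ ε₂₉ B₃ a₀ a₁) p) →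
      ∀ s : SeqOfRecord F (theta13OfThm1C F N ε₀ ε₂₉ B₃ a₀ a₁).ν (theta13OfThm1C F N ε₀ ε₂₉ B₃ a₀ a₁).τ9.M (gOfRecord₁₃ F N (theta13OfThm1C F N ε₀ ε₂₉ B₃ a₀ a₁) p) p.K n, Sect2.SeqSeparated (theta13OfThm1C F N ε₀ ε₂₉ B₃ a₀ a₁).ν.M₁ s → ∀ W : MSField (F.P p.K) (SU N),
      W ∈ suppOfRecord₁₃ F N (theta13OfThm1C F N ε₀ ε₂₉ B₃ a₀ a₁) p n s → W ∈ solvableDom (avOfRecord F N p.K) (regMSOfRecord F N (theta13OfThm1C F N ε₀ ε₂₉ B₃ a₀ a₁).ν p.K n s.Ω) (genSet s.Ω n) →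
      ∀ j, 1 ≤ j → j ≤ n → ∀ X : (Sect2.domSys (F.P p.K) (theta13OfThm1C F N ε₀ ε₂₉ B₃ a₀ a₁).τ9.M j).Dom, Sect2.domSites (F.P p.K) (theta13OfThm1C F N ε₀ ε₂₉ B₃ a₀ a₁).τ9.M j X ⊆ s.Λ j →
      ∀ a ∈ cubeIndices (F.P p.K) (B14.Eq213MaximalDomains.side (F.P p.K).L (theta13OfThm1C F N ε₀ ε₂₉ B₃ a₀ a₁).τ9.M (j + 1)),
        (cubeEnl (F.P p.K) (B14.Eq213MaximalDomains.side (F.P p.K).L (theta13OfThm1C F N ε₀ ε₂₉ B₃ a₀ a₁).τ9.M (j + 1)) a 0 ∩ Sect2.domSites (F.P p.K) (theta13OfThm1C F N ε₀ ε₂₉ B₃ a₀ a₁).τ9.M j X).Nonempty →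
        ∀ q ∈ (Sect2.regionOfSet (F.P p.K) (cubeEnl (F.P p.K) (B14.Eq213MaximalDomains.side (F.P p.K).L (theta13OfThm1C F N ε₀ ε₂₉ B₃ a₀ a₁).τ9.M (j + 1)) a 0 ∩
            Sect2.domSites (F.P p.K) (theta13OfThm1C F N ε₀ ε₂₉ B₃ a₀ a₁).τ9.M j X)).dpairs,
          ‖grad ((F.P p.K).eta j) q.2.1 (fun y => axialPotential (UbgMSOfRecord F N (theta13OfThm1C F N ε₀ ε₂₉ B₃ a₀ a₁).ν (theta13OfThm1C F N ε₀ ε₂₉ B₃ a₀ a₁).τ9.M (gOfRecord₁₃ F N (theta13OfThm1C F N ε₀ ε₂₉ B₃ a₀ a₁) p) p.K n s W)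
            (boxLo (B14.Eq213MaximalDomains.side (F.P p.K).L (theta13OfThm1C F N ε₀ ε₂₉ B₃ a₀ a₁).τ9.M (j + 1)) a) (boxHi (B14.Eq213MaximalDomains.side (F.P p.K).L (theta13OfThm1C F N ε₀ ε₂₉ B₃ a₀ a₁).τ9.M (j + 1)) a) ((F.P p.K).eta j) ⟨y, q.2.2⟩) q.1‖ <
            (theta13OfThm1C F N ε₀ ε₂₉ B₃ a₀ a₁).s2.cB * (lfOfRecord₁₂ F N (theta13OfThm1C F N ε₀ ε₂₉ B₃ a₀ a₁).toStage12Params).alpha0 (gOfRecord₁₃ F N (theta13OfThm1C F N ε₀ ε₂₉ B₃ a₀ a₁) p j))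
    (h3MS : ∀ (p : B12.RunParams) (n : ℕ), n ≤ p.K → Step.InInterval (theta13OfThm1C F N ε₀ ε₂₉ B₃ a₀ a₁).γ n (gOfRecord₁₃ F N (theta13OfThm1C F N ε₀ ε₂₉ B₃ a₀ a₁) p) →
      ∀ s : SeqOfRecord F (theta13OfThm1C F N ε₀ ε₂₉ B₃ a₀ a₁).ν (theta13OfThm1C F N ε₀ ε₂₉ B₃ a₀ a₁).τ9.M (gOfRecord₁₃ F N (theta13OfThm1C F N ε₀ ε₂₉ B₃ a₀ a₁) p) p.K n, Sect2.SeqSeparated (theta13OfThm1C F N ε₀ ε₂₉ B₃ a₀ a₁).ν.M₁ s → ∀ W : MSField (F.P p.K) (SU N),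
      W ∈ suppOfRecord₁₃ F N (theta13OfThm1C F N ε₀ ε₂₉ B₃ a₀ a₁) p n s → W ∈ solvableDom (avOfRecord F N p.K) (regMSOfRecord F N (theta13OfThm1C F N ε₀ ε₂₉ B₃ a₀ a₁).ν p.K n s.Ω) (genSet s.Ω n) →
      ∀ j, 1 ≤ j → j ≤ n → ∀ X : (Sect2.domSys (F.P p.K) (theta13OfThm1C F N ε₀ ε₂₉ B₃ a₀ a₁).τ9.M j).Dom, ∀ m, 1 ≤ m → m ≤ j →
      ∀ a ∈ cubeIndices (F.P p.K) (B14.Eq213MaximalDomains.side (F.P p.K).L (theta13OfThm1C F N ε₀ ε₂₉ B₃ a₀ a₁).τ9.M m),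
        (cubeEnl (F.P p.K) (B14.Eq213MaximalDomains.side (F.P p.K).L (theta13OfThm1C F N ε₀ ε₂₉ B₃ a₀ a₁).τ9.M m) a 0 ∩ Sect2.domSites (F.P p.K) (theta13OfThm1C F N ε₀ ε₂₉ B₃ a₀ a₁).τ9.M j X).Nonempty →
        cubeEnl (F.P p.K) (B14.Eq213MaximalDomains.side (F.P p.K).L (theta13OfThm1C F N ε₀ ε₂₉ B₃ a₀ a₁).τ9.M m) a 0 ⊆ s.Ω m →
        ∀ q ∈ (Sect2.regionOfSet (F.P p.K) (cubeEnl (F.P p.K) (B14.Eq213MaximalDomains.side (F.P p.K).L (theta13OfThm1C F N ε₀ ε₂₉ B₃ a₀ a₁).τ9.M m) a 0 ∩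
            Sect2.domSites (F.P p.K) (theta13OfThm1C F N ε₀ ε₂₉ B₃ a₀ a₁).τ9.M j X)).dpairs,
          (((F.P p.K).L : ℝ) ^ m * (F.P p.K).eta j) ^ 2 *
            ‖grad ((F.P p.K).eta j) q.2.1 (fun y => axialPotential (UbgMSOfRecord F N (theta13OfThm1C F N ε₀ ε₂₉ B₃ a₀ a₁).ν (theta13OfThm1C F N ε₀ ε₂₉ B₃ a₀ a₁).τ9.M (gOfRecord₁₃ F N (theta13OfThm1C F N ε₀ ε₂₉ B₃ a₀ a₁) p) p.K n s W)
              (boxLo (B14.Eq213MaximalDomains.side (F.P p.K).L (theta13OfThm1C F N ε₀ ε₂₉ B₃ a₀ a₁).τ9.M m) a) (boxHi (B14.Eq213MaximalDomains.side (F.P p.K).L (theta13OfThm1C F N ε₀ ε₂₉ B₃ a₀ a₁).τ9.M m) a) ((F.P p.K).eta j) ⟨y, q.2.2⟩) q.1‖ <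
            rad238 (theta13OfThm1C F N ε₀ ε₂₉ B₃ a₀ a₁).s2.B (theta13OfThm1C F N ε₀ ε₂₉ B₃ a₀ a₁).s2.C (theta13OfThm1C F N ε₀ ε₂₉ B₃ a₀ a₁).s2.Mr ((lfOfRecord₁₂ F N (theta13OfThm1C F N ε₀ ε₂₉ B₃ a₀ a₁).toStage12Params).alpha0 (gOfRecord₁₃ F N (theta13OfThm1C F N ε₀ ε₂₉ B₃ a₀ a₁) p m))) :
    ∀ (p : B12.RunParams) (n : ℕ), n ≤ p.K → Step.InInterval (theta13OfThm1C F N ε₀ ε₂₉ B₃ a₀ a₁).γ n (gOfRecord₁₃ F N (theta13OfThm1C F N ε₀ ε₂₉ B₃ a₀ a₁) p) → PartCompat₁₃ F N (theta13OfThm1C F N ε₀ ε₂₉ B₃ a₀ a₁) p n →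
      ∀ s : SeqOfRecord F (theta13OfThm1C F N ε₀ ε₂₉ B₃ a₀ a₁).ν (theta13OfThm1C F N ε₀ ε₂₉ B₃ a₀ a₁).τ9.M (gOfRecord₁₃ F N (theta13OfThm1C F N ε₀ ε₂₉ B₃ a₀ a₁) p) p.K n, Sect2.SeqSeparated (theta13OfThm1C F N ε₀ ε₂₉ B₃ a₀ a₁).ν.M₁ s →
      ∀ W : MSField (F.P p.K) (SU N), W ∈ suppOfRecord₁₃ F N (theta13OfThm1C F N ε₀ ε₂₉ B₃ a₀ a₁) p n s →
      ∀ j, 1 ≤ j → j ≤ n → ∀ X : (Sect2.domSys (F.P p.K) (theta13OfThm1C F N ε₀ ε₂₉ B₃ a₀ a₁).τ9.M j).Dom,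
      (Sect2.domSites (F.P p.K) (theta13OfThm1C F N ε₀ ε₂₉ B₃ a₀ a₁).τ9.M j X ⊆ s.Λ j →
        Sect2.ofBackgroundC (settingOfRecord₁₃ F N (theta13OfThm1C F N ε₀ ε₂₉ B₃ a₀ a₁) p).ι (UbgOfRecord₁₃ F N (theta13OfThm1C F N ε₀ ε₂₉ B₃ a₀ a₁) p n s W) ∈
          Sect2.spaceI (settingOfRecord₁₃ F N (theta13OfThm1C F N ε₀ ε₂₉ B₃ a₀ a₁) p) ((theta13OfThm1C F N ε₀ ε₂₉ B₃ a₀ a₁).Rz p.K) (theta13OfThm1C F N ε₀ ε₂₉ B₃ a₀ a₁).τ9.M j (Sect2.domSites (F.P p.K) (theta13OfThm1C F N ε₀ ε₂₉ B₃ a₀ a₁).τ9.M j X)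
            ((settingOfRecord₁₃ F N (theta13OfThm1C F N ε₀ ε₂₉ B₃ a₀ a₁) p).lf.alpha0 ((settingOfRecord₁₃ F N (theta13OfThm1C F N ε₀ ε₂₉ B₃ a₀ a₁) p).flow.g j)) ((settingOfRecord₁₃ F N (theta13OfThm1C F N ε₀ ε₂₉ B₃ a₀ a₁) p).lf.alpha1 ((settingOfRecord₁₃ F N (theta13OfThm1C F N ε₀ ε₂₉ B₃ a₀ a₁) p).flow.g j))) ∧
      (Sect2.admB (F.P p.K) (theta13OfThm1C F N ε₀ ε₂₉ B₃ a₀ a₁).ν (theta13OfThm1C F N ε₀ ε₂₉ B₃ a₀ a₁).τ9.M (gOfRecord₁₃ F N (theta13OfThm1C F N ε₀ ε₂₉ B₃ a₀ a₁) p) s.Ω s.Λ j (Sect2.domSites (F.P p.K) (theta13OfThm1C F N ε₀ ε₂₉ B₃ a₀ a₁).τ9.M j X) = true →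
        Sect2.ofBackgroundC (settingOfRecord₁₃ F N (theta13OfThm1C F N ε₀ ε₂₉ B₃ a₀ a₁) p).ι (UbgOfRecord₁₃ F N (theta13OfThm1C F N ε₀ ε₂₉ B₃ a₀ a₁) p n s W) ∈
          Sect2.spaceMS (settingOfRecord₁₃ F N (theta13OfThm1C F N ε₀ ε₂₉ B₃ a₀ a₁) p) ((theta13OfThm1C F N ε₀ ε₂₉ B₃ a₀ a₁).Rz p.K) (theta13OfThm1C F N ε₀ ε₂₉ B₃ a₀ a₁).τ9.M j (Sect2.domSites (F.P p.K) (theta13OfThm1C F N ε₀ ε₂₉ B₃ a₀ a₁).τ9.M j X) s.Ω) :=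
  bgSepAt_theta13OfThm1C_of_thm1ScaledSep hε hε' hB ha₀ ha₁ h15 (hcomp_theta13OfThm1C_of_monotone hB ha₀.le ha₁.le hmono) h3I h3MS

end AtWitness

end Literature.MathematicalPhysics.QuantumFieldTheory.Balaban1983to89.Node00

end
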